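import Literature.MathematicalPhysics.KineticTheory.CollisionTubePairMeanLowerBound
import Literature.MathematicalPhysics.KineticTheory.HardSphereCrossSection
import Summits.AtomisticToContinuum.HydrodynamicLimit.Theorems.OneFlightGossipEngineEnergyCurrentTailsRungHalfHotSpot
import HarnessLib

/-!
# Rung ½ for `EnergyCurrentTails` (stmt-AtomisticToContinuum-9235), seat c4, line `level-census-comparison`:
# preliminaries of stub B `stub_tubeMeanLower` (the static main term)

Inputs of the inhomogeneous pair tube mean lower bound under the hot-spot local Gibbs law (activity `a`,
drift `0`, temperature `θhot x = 2 − ‖x‖ ∈ [3/2, 2]`) for the mark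
`Ξ_b(n, v, w) = (1 − ‖v − b‖)₊ (1 − ‖w + b‖)₊` (`b = Ve₁`, `‖b‖ = V`): its support, its sphere integral
`Θ Ξ_b v w = Ξ_b π‖w − v‖ ≥ πV Ξ_b` (`integral_hardSphereKernel_eq_pi_mul_norm`), the Gaussian DENSITY
COMPARISON at nearby temperatures `tml_gauss_ratio` (registered helper: for `θ, θ' ≥ 3/2`, `|θ − θ'| ≤ 2ε`,
`‖v‖ ≤ V + 1`, `ε(V+1)² ≤ 1/16` the centred Maxwellian at `θ'` is at least half the one at `θ`), the pair
marginal of a product of non-identical Gaussians, the Tonelli identity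
`∫∫ Ξ_b (∫_y g_{θhot y} ⊗ g_{θhot y}) = ∫_y G_b G⁻_b` for the ideal term, and the support / measurability of
the comparison integrand `g_{θhot xᵢ}(v) g_{θhot xᵢ}(v') · ½ tubeMark κ Ξ_b (ε⁻¹ reprSym (xᵢ − xⱼ)) v v'`.
-/

noncomputable section

open MeasureTheory Set Filter
open scoped ENNReal InnerProductSpace BigOperators Classical Pointwise

namespace Summit.AtomisticToContinuum.HydrodynamicLimit.Theorems.EnergyCurrentTailsRungHalf

open Literature.MathematicalPhysics.KineticTheory Literature.Analysis.FluidPDE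

/-- `0 ≤ ξ_b(v, w) ≤ 1` for the scalar mark `ξ_b(v, w) = (1 − ‖v − b‖)₊ (1 − ‖w + b‖)₊`. -/
private theorem ξ_mem (b v w : V3) :
    0 ≤ max 0 (1 - ‖v - b‖) * max 0 (1 - ‖w + b‖) ∧ max 0 (1 - ‖v - b‖) * max 0 (1 - ‖w + b‖) ≤ 1 :=
  ⟨mul_nonneg (le_max_left _ _) (le_max_left _ _),
    mul_le_one₀ (max_le zero_le_one (by linarith [norm_nonneg (v - b)])) (le_max_left _ _)
      (max_le zero_le_one (by linarith [norm_nonneg (w + b)]))⟩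

/-- The mark `Ξ_b(n, v, w) = ξ_b(v, w)` is measurable, nonnegative and bounded by `1`. -/
theorem tml_mark_facts (b : V3) :
    Measurable (fun q : V3 × V3 × V3 => max 0 (1 - ‖q.2.1 - b‖) * max 0 (1 - ‖q.2.2 + b‖)) ∧
      (∀ q : V3 × V3 × V3, 0 ≤ (fun q : V3 × V3 × V3 => max 0 (1 - ‖q.2.1 - b‖) * max 0 (1 - ‖q.2.2 + b‖)) q) ∧
      (∀ q : V3 × V3 × V3, |(fun q : V3 × V3 × V3 => max 0 (1 - ‖q.2.1 - b‖) * max 0 (1 - ‖q.2.2 + b‖)) q| ≤ 1) := by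
  refine ⟨by fun_prop, fun q => (ξ_mem b q.2.1 q.2.2).1, fun q => ?_⟩
  show |max 0 (1 - ‖q.2.1 - b‖) * max 0 (1 - ‖q.2.2 + b‖)| ≤ 1
  rw [abs_of_nonneg (ξ_mem b _ _).1]
  exact (ξ_mem b _ _).2

/-- On the support of `ξ_b` (`‖b‖ = V ≥ 0`): `‖v‖ < V + 1`, `‖w‖ < V + 1`, `‖v − w‖ < 2(V+1)` and
`2V − 2 < ‖w − v‖`. -/
theorem tml_mark_support_norms {b : V3} {V : ℝ} (hb : ‖b‖ = V) {v w : V3}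
    (h : max 0 (1 - ‖v - b‖) * max 0 (1 - ‖w + b‖) ≠ 0) :
    ‖v‖ < V + 1 ∧ ‖w‖ < V + 1 ∧ ‖v - w‖ < 2 * (V + 1) ∧ 2 * V - 2 < ‖w - v‖ := by
  rcases mul_ne_zero_iff.1 h with ⟨h1, h2⟩
  have hv : ‖v - b‖ < 1 := by
    by_contra hc
    exact h1 (max_eq_left (by linarith [not_lt.1 hc]))
  have hw : ‖w + b‖ < 1 := by
    by_contra hc
    exact h2 (max_eq_left (by linarith [not_lt.1 hc]))
  have h2b : ‖b + b‖ = 2 * V := by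
    rw [← two_smul ℝ b, norm_smul, Real.norm_of_nonneg zero_le_two, hb]
  refine ⟨?_, ?_, ?_, ?_⟩
  · calc ‖v‖ = ‖(v - b) + b‖ := by rw [sub_add_cancel]
      _ ≤ ‖v - b‖ + ‖b‖ := norm_add_le _ _
      _ < V + 1 := by rw [hb]; linarith
  · calc ‖w‖ = ‖(w + b) - b‖ := by rw [add_sub_cancel_right]
      _ ≤ ‖w + b‖ + ‖b‖ := norm_sub_le _ _
      _ < V + 1 := by rw [hb]; linarith
  · have e1 : v - w = (v - b) + ((b + b) - (w + b)) := by abel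
    calc ‖v - w‖ = ‖(v - b) + ((b + b) - (w + b))‖ := by rw [← e1]
      _ ≤ ‖v - b‖ + ‖(b + b) - (w + b)‖ := norm_add_le _ _
      _ ≤ ‖v - b‖ + (‖b + b‖ + ‖w + b‖) := by gcongr; exact norm_sub_le _ _
      _ < 1 + (2 * V + 1) := by rw [h2b]; linarith
      _ = 2 * (V + 1) := by ring
  · have e2 : b + b = (w + b) - (v - b) - (w - v) := by abel
    have h3 : ‖b + b‖ ≤ ‖w + b‖ + ‖v - b‖ + ‖w - v‖ := by
      rw [e2]
      exact (norm_sub_le _ _).trans (by gcongr; exact norm_sub_le _ _)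
    rw [h2b] at h3
    linarith

/-- `Ξ_b` vanishes at relative speed `≥ 2(V+1)` (`‖b‖ = V`). -/
theorem tml_mark_speedCutoff {b : V3} {V : ℝ} (hb : ‖b‖ = V) : ∀ m v v' : V3, 2 * (V + 1) ≤ ‖v - v'‖ →
    (fun q : V3 × V3 × V3 => max 0 (1 - ‖q.2.1 - b‖) * max 0 (1 - ‖q.2.2 + b‖)) (m, v, v') = 0 := by
  intro m v v' h
  by_contra hne
  have := (tml_mark_support_norms hb hne).2.2.1
  linarith

/-- `π V ξ_b(v, w) ≤ Θ Ξ_b v w` for `‖b‖ = V ≥ 2`: `Θ Ξ_b v w = ξ_b(v, w) · π‖w − v‖`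
(`integral_hardSphereKernel_eq_pi_mul_norm`) and on the support the relative speed exceeds `2V − 2 ≥ V`. -/
theorem tml_sphereMark_mark_ge {b : V3} {V : ℝ} (hb : ‖b‖ = V) (hV : 2 ≤ V) (v w : V3) :
    Real.pi * V * (max 0 (1 - ‖v - b‖) * max 0 (1 - ‖w + b‖)) ≤
      sphereMark (fun q : V3 × V3 × V3 => max 0 (1 - ‖q.2.1 - b‖) * max 0 (1 - ‖q.2.2 + b‖)) v w := by
  have hΘ : sphereMark (fun q : V3 × V3 × V3 => max 0 (1 - ‖q.2.1 - b‖) * max 0 (1 - ‖q.2.2 + b‖)) v w =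
      (max 0 (1 - ‖v - b‖) * max 0 (1 - ‖w + b‖)) * (Real.pi * ‖w - v‖) := by
    show (∫ ω : Metric.sphere (0 : V3) 1, (max 0 (1 - ‖v - b‖) * max 0 (1 - ‖w + b‖)) *
      hardSphereKernel (w, v) ω ∂sphereMeasure) = _
    rw [integral_const_mul, integral_hardSphereKernel_eq_pi_mul_norm]
  rw [hΘ]
  by_cases h0 : max 0 (1 - ‖v - b‖) * max 0 (1 - ‖w + b‖) = 0
  · rw [h0]; simp
  · have h := (tml_mark_support_norms hb h0).2.2.2
    have hVle : V ≤ ‖w - v‖ := by linarith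
    have hΞ := (ξ_mem b v w).1
    calc Real.pi * V * (max 0 (1 - ‖v - b‖) * max 0 (1 - ‖w + b‖))
        = (max 0 (1 - ‖v - b‖) * max 0 (1 - ‖w + b‖)) * (Real.pi * V) := by ring
      _ ≤ (max 0 (1 - ‖v - b‖) * max 0 (1 - ‖w + b‖)) * (Real.pi * ‖w - v‖) := by gcongr

/-- The hot-spot temperature is positive. -/
private theorem θhot_pos (y : T3) : 0 < 2 - ‖y‖ := by linarith [(hot_bounds y).1]

/-- The centred Maxwellian at temperature `θ ≥ 3/2` is bounded by `1`. -/
private theorem gauss_le_one {θ : ℝ} (hθ : 3 / 2 ≤ θ) (v : V3) : localMaxwellian 1 θ (0 : V3) v ≤ 1 := by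
  unfold localMaxwellian
  have hπ := Real.pi_gt_three
  have h1 : (2 * Real.pi * θ) ^ (-(Module.finrank ℝ V3 : ℝ) / 2) ≤ 1 :=
    Real.rpow_le_one_of_one_le_of_nonpos (by nlinarith) (by
      have : (0 : ℝ) ≤ (Module.finrank ℝ V3 : ℝ) := Nat.cast_nonneg _
      linarith)
  have h2 : Real.exp (-‖v - 0‖ ^ 2 / (2 * θ)) ≤ 1 := by
    rw [Real.exp_le_one_iff, neg_div]
    exact neg_nonpos.2 (by positivity)
  rw [one_mul]
  exact mul_le_one₀ h1 (Real.exp_pos _).le h2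

/-- **Density comparison** (registered helper): for temperatures `θ, θ' ≥ 3/2` with `|θ − θ'| ≤ 2ε`, speeds
`‖v‖ ≤ V + 1` and `ε (V+1)² ≤ 1/16`, the centred Maxwellian at `θ'` is at least half the one at `θ`:
`(θ/θ')^{3/2} exp(−‖v‖² (1/θ' − 1/θ)/2) ≥ exp(−2ε − 1/36) ≥ 1/2`. -/
theorem tml_gauss_ratio :
    ∀ (θ θ' ε V : ℝ) (v : V3), 3 / 2 ≤ θ → 3 / 2 ≤ θ' → |θ - θ'| ≤ 2 * ε → ‖v‖ ≤ V + 1 → 0 ≤ V →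
      ε * (V + 1) ^ 2 ≤ 1 / 16 → (1 / 2) * localMaxwellian 1 θ (0 : V3) v ≤ localMaxwellian 1 θ' (0 : V3) v := by
  intro θ θ' ε V v hθ hθ' hd hv hV hεV
  have hπ := Real.pi_gt_three
  have hε0 : 0 ≤ ε := by linarith [abs_nonneg (θ - θ')]
  have hθ0 : 0 < θ := by linarith
  have hθ0' : 0 < θ' := by linarith
  have hε16 : ε ≤ 1 / 16 := by
    have h1 : (1 : ℝ) ≤ (V + 1) ^ 2 := by nlinarith
    calc ε = ε * 1 := (mul_one ε).symm
      _ ≤ ε * (V + 1) ^ 2 := mul_le_mul_of_nonneg_left h1 hε0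
      _ ≤ 1 / 16 := hεV
  have hsV : ‖v‖ ^ 2 ≤ (V + 1) ^ 2 := pow_le_pow_left₀ (norm_nonneg _) hv 2
  have hs0 : 0 ≤ ‖v‖ ^ 2 := by positivity
  have hA : ∀ t : ℝ, 0 < t → (2 * Real.pi * t) ^ (-(Module.finrank ℝ V3 : ℝ) / 2) =
      Real.exp (-(3 : ℝ) / 2 * Real.log (2 * Real.pi * t)) := fun t ht => by
    rw [finrank_euclideanSpace_fin, Real.rpow_def_of_pos (by positivity), mul_comm]
    norm_num
  unfold localMaxwellian
  rw [hA θ hθ0, hA θ' hθ0', one_mul, one_mul, sub_zero, ← Real.exp_add, ← Real.exp_add]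
  -- the exponents differ by at most `1/2`
  have hlog : Real.log (2 * Real.pi * θ') - Real.log (2 * Real.pi * θ) ≤ (θ' - θ) / θ := by
    rw [← Real.log_div (by positivity) (by positivity)]
    have h := Real.log_le_sub_one_of_pos (show 0 < 2 * Real.pi * θ' / (2 * Real.pi * θ) by positivity)
    have e : 2 * Real.pi * θ' / (2 * Real.pi * θ) - 1 = (θ' - θ) / θ := by
      field_simp
    linarith
  have h1 : (θ' - θ) / θ ≤ 4 * ε / 3 := by
    rw [div_le_iff₀ hθ0]
    have := (abs_sub_comm θ θ' ▸ hd)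
    nlinarith [le_abs_self (θ' - θ)]
  have h2 : ‖v‖ ^ 2 / (2 * θ') - ‖v‖ ^ 2 / (2 * θ) ≤ 1 / 36 := by
    rw [div_sub_div _ _ (by positivity) (by positivity), div_le_iff₀ (by positivity)]
    have hp1 : ‖v‖ ^ 2 * (θ - θ') ≤ ‖v‖ ^ 2 * (2 * ε) :=
      mul_le_mul_of_nonneg_left ((le_abs_self _).trans hd) hs0
    have hp2 : ‖v‖ ^ 2 * (2 * ε) ≤ (V + 1) ^ 2 * (2 * ε) := mul_le_mul_of_nonneg_right hsV (by linarith)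
    have hp3 : (3 / 2) * (3 / 2) ≤ θ * θ' := mul_le_mul hθ hθ' (by norm_num) (by linarith)
    nlinarith
  have hkey : (-(3 : ℝ) / 2 * Real.log (2 * Real.pi * θ) + -‖v‖ ^ 2 / (2 * θ)) -
      (-(3 : ℝ) / 2 * Real.log (2 * Real.pi * θ') + -‖v‖ ^ 2 / (2 * θ')) ≤ 1 / 2 := by
    have : (-(3 : ℝ) / 2 * Real.log (2 * Real.pi * θ) + -‖v‖ ^ 2 / (2 * θ)) -
        (-(3 : ℝ) / 2 * Real.log (2 * Real.pi * θ') + -‖v‖ ^ 2 / (2 * θ')) =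
        3 / 2 * (Real.log (2 * Real.pi * θ') - Real.log (2 * Real.pi * θ)) +
          (‖v‖ ^ 2 / (2 * θ') - ‖v‖ ^ 2 / (2 * θ)) := by ring
    rw [this]
    nlinarith
  set X := -(3 : ℝ) / 2 * Real.log (2 * Real.pi * θ) + -‖v‖ ^ 2 / (2 * θ) with hX
  set X' := -(3 : ℝ) / 2 * Real.log (2 * Real.pi * θ') + -‖v‖ ^ 2 / (2 * θ') with hX'
  have hhalf : (1 : ℝ) / 2 ≤ Real.exp (-1 / 2) := by
    have := Real.add_one_le_exp (-1 / 2 : ℝ)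
    linarith
  calc 1 / 2 * Real.exp X ≤ Real.exp (-1 / 2) * Real.exp X :=
        mul_le_mul_of_nonneg_right hhalf (Real.exp_pos _).le
    _ = Real.exp (X - 1 / 2) := by rw [← Real.exp_add]; ring_nf
    _ ≤ Real.exp X' := Real.exp_le_exp.2 (by linarith)

/-- The centred Maxwellian at the hot-spot temperature `2 − ‖y‖` is continuous in `y ∈ 𝕋³`, and the product
of two of them lies in `[0, 1]`. -/
theorem tml_gauss_hot (v w : V3) : (Continuous fun y : T3 => localMaxwellian 1 (2 - ‖y‖) (0 : V3) v) ∧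
    ∀ y : T3, 0 ≤ localMaxwellian 1 (2 - ‖y‖) (0 : V3) v * localMaxwellian 1 (2 - ‖y‖) (0 : V3) w ∧
      localMaxwellian 1 (2 - ‖y‖) (0 : V3) v * localMaxwellian 1 (2 - ‖y‖) (0 : V3) w ≤ 1 := by
  refine ⟨?_, fun y => ?_⟩
  · unfold localMaxwellian
    have hθ : Continuous fun y : T3 => 2 - ‖y‖ := continuous_const.sub continuous_norm
    refine (continuous_const.mul ?_).mul ?_
    · exact (continuous_const.mul hθ).rpow_const fun y =>
        Or.inl (mul_pos (mul_pos two_pos Real.pi_pos) (θhot_pos y)).ne'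
    · exact Real.continuous_exp.comp
        (continuous_const.div (continuous_const.mul hθ) fun y => (mul_pos two_pos (θhot_pos y)).ne')
  · have h1 := localMaxwellian_nonneg zero_le_one (θhot_pos y).le (0 : V3) v
    have h2 := localMaxwellian_nonneg zero_le_one (θhot_pos y).le (0 : V3) w
    exact ⟨mul_nonneg h1 h2, mul_le_one₀ (gauss_le_one (hot_bounds y).1 v) h2 (gauss_le_one (hot_bounds y).1 w)⟩

/-- Two distinct coordinates of a product of probability measures are distributed as the product of
the two factors (`lintegral` form, non-identical factors). -/
theorem tml_lintegral_pi_pair {n : ℕ} (μ : Fin n → Measure V3) [∀ m, IsProbabilityMeasure (μ m)]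
    {i j : Fin n} (hij : i ≠ j) {f : V3 × V3 → ℝ≥0∞} (hf : Measurable f) :
    ∫⁻ v, f (v i, v j) ∂Measure.pi μ = ∫⁻ p, f p ∂((μ i).prod (μ j)) := by
  -- adapted from `CollisionFluxUpperBound.lintegral_pi_pair`
  have hind : ProbabilityTheory.IndepFun (fun v : Fin n → V3 => v i) (fun v => v j) (Measure.pi μ) :=
    (ProbabilityTheory.iIndepFun_pi (μ := μ) (X := fun _ => id) fun _ => aemeasurable_id).indepFun hij
  have hev : ∀ k, (Measure.pi μ).map (fun v => v k) = μ k := fun k => (measurePreserving_eval μ k).map_eq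
  have hmap : (Measure.pi μ).map (fun v => (v i, v j)) = (μ i).prod (μ j) := by
    rw [(ProbabilityTheory.indepFun_iff_map_prod_eq_prod_map_map (measurable_pi_apply i).aemeasurable
      (measurable_pi_apply j).aemeasurable).1 hind, hev i, hev j]
  rw [← hmap, lintegral_map hf ((measurable_pi_apply i).prodMk (measurable_pi_apply j))]

/-- The product of two centred Gaussian laws has density `g_{θ₁}(v) g_{θ₂}(w)` (`lintegral` form). -/
theorem tml_lintegral_prod_gauss {θ₁ θ₂ : ℝ} (h₁ : 0 < θ₁) (h₂ : 0 < θ₂) {F : V3 × V3 → ℝ≥0∞}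
    (hF : Measurable F) :
    ∫⁻ p, F p ∂((gaussMeasure (0 : V3) θ₁).prod (gaussMeasure (0 : V3) θ₂)) =
      ∫⁻ p : V3 × V3, ENNReal.ofReal (localMaxwellian 1 θ₁ (0 : V3) p.1 * localMaxwellian 1 θ₂ (0 : V3) p.2) * F p := by
  have hm : ∀ θ : ℝ, Measurable fun v : V3 => ENNReal.ofReal (localMaxwellian 1 θ (0 : V3) v) := fun θ =>
    (continuous_localMaxwellian 1 θ (0 : V3)).measurable.ennreal_ofReal
  have hm2 : Measurable fun z : V3 × V3 =>
      ENNReal.ofReal (localMaxwellian 1 θ₁ (0 : V3) z.1) * ENNReal.ofReal (localMaxwellian 1 θ₂ (0 : V3) z.2) :=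
    ((hm θ₁).comp measurable_fst).mul ((hm θ₂).comp measurable_snd)
  rw [← withDensity_localMaxwellian_eq_gaussMeasure h₁ (0 : V3), ← withDensity_localMaxwellian_eq_gaussMeasure h₂ (0 : V3),
    prod_withDensity (hm θ₁) (hm θ₂),
    show ((volume : Measure V3).prod (volume : Measure V3)) = (volume : Measure (V3 × V3)) from rfl,
    lintegral_withDensity_eq_lintegral_mul _ hm2 hF]
  refine lintegral_congr fun p => ?_
  rw [Pi.mul_apply, ENNReal.ofReal_mul (localMaxwellian_nonneg zero_le_one h₁.le _ _)]

/-- `0 ≤ G_b, G⁻_b ≤ 1` at the hot-spot temperature, and `G⁻_b = G_b` (reflection symmetry). -/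
theorem tml_G_facts (b : V3) (y : T3) :
    (0 ≤ ∫ v, max 0 (1 - ‖v - b‖) ∂gaussMeasure (0 : V3) (2 - ‖y‖) ∧
      ∫ v, max 0 (1 - ‖v - b‖) ∂gaussMeasure (0 : V3) (2 - ‖y‖) ≤ 1) ∧
    ∫ v, max 0 (1 - ‖v + b‖) ∂gaussMeasure (0 : V3) (2 - ‖y‖) =
      ∫ v, max 0 (1 - ‖v - b‖) ∂gaussMeasure (0 : V3) (2 - ‖y‖) :=
  ⟨⟨(gaussBump_pos_le (θhot_pos y) b).1.le, (gaussBump_pos_le (θhot_pos y) b).2⟩, gaussBump_reflect (θhot_pos y) b⟩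

/-- **Tonelli for the ideal term**: `∫∫ ξ_b(v, w) (∫_y g_{θhot y}(v) g_{θhot y}(w) dy) dv dw = ∫_y G_b G⁻_b dy`. -/
theorem tml_tonelli (b : V3) :
    ∫⁻ p : V3 × V3, ENNReal.ofReal ((max 0 (1 - ‖p.1 - b‖) * max 0 (1 - ‖p.2 + b‖)) *
        ∫ y : T3, localMaxwellian 1 (2 - ‖y‖) (0 : V3) p.1 * localMaxwellian 1 (2 - ‖y‖) (0 : V3) p.2) =
      ENNReal.ofReal (∫ y : T3, (∫ v, max 0 (1 - ‖v - b‖) ∂gaussMeasure (0 : V3) (2 - ‖y‖)) *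
        (∫ v, max 0 (1 - ‖v + b‖) ∂gaussMeasure (0 : V3) (2 - ‖y‖))) := by
  set g : T3 → V3 → ℝ := fun y v => localMaxwellian 1 (2 - ‖y‖) (0 : V3) v with hg
  set B : V3 × V3 → ℝ := fun p => max 0 (1 - ‖p.1 - b‖) * max 0 (1 - ‖p.2 + b‖) with hB
  have hB0 : ∀ p, 0 ≤ B p := fun p => (ξ_mem b p.1 p.2).1
  have hBc : Continuous B := by rw [hB]; fun_prop
  show ∫⁻ p : V3 × V3, ENNReal.ofReal (B p * ∫ y : T3, g y p.1 * g y p.2) =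
    ENNReal.ofReal (∫ y : T3, (∫ v, max 0 (1 - ‖v - b‖) ∂gaussMeasure (0 : V3) (2 - ‖y‖)) *
        (∫ v, max 0 (1 - ‖v + b‖) ∂gaussMeasure (0 : V3) (2 - ‖y‖)))
  -- inside: `ofReal ∫ = ∫⁻ ofReal`
  have h1 : ∀ p : V3 × V3, ENNReal.ofReal (B p * ∫ y : T3, g y p.1 * g y p.2) =
      ∫⁻ y : T3, ENNReal.ofReal (B p * (g y p.1 * g y p.2)) := by
    intro p
    rw [← integral_const_mul]
    refine ofReal_integral_eq_lintegral_ofReal ?_ (ae_of_all _ fun y => mul_nonneg (hB0 p) ((tml_gauss_hot p.1 p.2).2 y).1)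
    exact (integrable_of_continuous_T3 ((tml_gauss_hot p.1 p.1).1.mul (tml_gauss_hot p.2 p.2).1)).const_mul _
  simp_rw [h1]
  -- swap
  have hmeas : Measurable (Function.uncurry fun (p : V3 × V3) (y : T3) => ENNReal.ofReal (B p * (g y p.1 * g y p.2))) := by
    simp only [hB, hg, localMaxwellian]
    fun_prop
  rw [lintegral_lintegral_swap hmeas.aemeasurable]
  -- per `y`
  have h3 : ∀ y : T3, ∫⁻ p : V3 × V3, ENNReal.ofReal (B p * (g y p.1 * g y p.2)) =
      ENNReal.ofReal ((∫ v, max 0 (1 - ‖v - b‖) ∂gaussMeasure (0 : V3) (2 - ‖y‖)) *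
        (∫ v, max 0 (1 - ‖v + b‖) ∂gaussMeasure (0 : V3) (2 - ‖y‖))) := by
    intro y
    have hgi : Integrable (fun p : V3 × V3 => g y p.1 * g y p.2) (volume : Measure (V3 × V3)) :=
      (integrable_localMaxwellian (θhot_pos y) (0 : V3)).mul_prod (integrable_localMaxwellian (θhot_pos y) (0 : V3))
    have hint : Integrable (fun p : V3 × V3 => B p * (g y p.1 * g y p.2)) :=
      hgi.bdd_mul hBc.measurable.aestronglyMeasurable
        (ae_of_all _ fun p => by rw [Real.norm_eq_abs, abs_of_nonneg (hB0 p)]; exact (ξ_mem b p.1 p.2).2)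
    rw [← ofReal_integral_eq_lintegral_ofReal hint (ae_of_all _ fun p => mul_nonneg (hB0 p) ((tml_gauss_hot p.1 p.2).2 y).1)]
    congr 1
    rw [← integral_prod_gaussMeasure (θhot_pos y) (0 : V3) B]
    exact integral_prod_mul (μ := gaussMeasure (0 : V3) (2 - ‖y‖)) (ν := gaussMeasure (0 : V3) (2 - ‖y‖))
      (fun v : V3 => max 0 (1 - ‖v - b‖)) (fun w : V3 => max 0 (1 - ‖w + b‖))
  simp_rw [h3]
  have hGm : Measurable fun y : T3 => ∫ v, max 0 (1 - ‖v - b‖) ∂gaussMeasure (0 : V3) (2 - ‖y‖) :=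
    (continuous_gaussBump_hot b).measurable
  have e : (fun y : T3 => ∫ v, max 0 (1 - ‖v + b‖) ∂gaussMeasure (0 : V3) (2 - ‖y‖)) =
      fun y : T3 => ∫ v, max 0 (1 - ‖v - b‖) ∂gaussMeasure (0 : V3) (2 - ‖y‖) := funext fun y => (tml_G_facts b y).2
  have hGint : Integrable (fun y : T3 => (∫ v, max 0 (1 - ‖v - b‖) ∂gaussMeasure (0 : V3) (2 - ‖y‖)) *
      (∫ v, max 0 (1 - ‖v + b‖) ∂gaussMeasure (0 : V3) (2 - ‖y‖))) := by
    refine Integrable.of_bound (hGm.mul (by rw [e]; exact hGm)).aestronglyMeasurable 1 (ae_of_all _ fun y => ?_)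
    obtain ⟨⟨h0, h1⟩, h2⟩ := tml_G_facts b y
    rw [h2, Real.norm_eq_abs, abs_of_nonneg (mul_nonneg h0 h0)]
    exact mul_le_one₀ h1 h0 h1
  refine (ofReal_integral_eq_lintegral_ofReal hGint (ae_of_all _ fun y => ?_)).symm
  obtain ⟨⟨h0, -⟩, h2⟩ := tml_G_facts b y
  simp only [Pi.zero_apply, h2]
  exact mul_nonneg h0 h0

/-- The tube mark of `Ξ_b` lies in `[0, 1]`. -/
theorem tml_tubeMark_mem (κ : ℝ) (b q v v' : V3) :
    0 ≤ tubeMark κ (fun q : V3 × V3 × V3 => max 0 (1 - ‖q.2.1 - b‖) * max 0 (1 - ‖q.2.2 + b‖)) q v v' ∧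
      tubeMark κ (fun q : V3 × V3 × V3 => max 0 (1 - ‖q.2.1 - b‖) * max 0 (1 - ‖q.2.2 + b‖)) q v v' ≤ 1 := by
  refine ⟨?_, (le_abs_self _).trans (abs_tubeMark_le (tml_mark_facts b).2.2 q v v')⟩
  unfold tubeMark
  split_ifs
  · exact (ξ_mem b _ _).1
  · exact le_rfl

/-- **Support of the pair tube mark of `Ξ_b`** (`‖b‖ = V ≥ 0`): if
`tubeMark κ Ξ_b (ε⁻¹ reprSym (xᵢ − xⱼ)) v v' ≠ 0` (`κ ≥ 0`, `2(V+1)κ ≤ 1`), then `|‖xᵢ‖ − ‖xⱼ‖| ≤ 2ε` and both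
speeds are `< V + 1`. -/
theorem tml_tubeMark_support {κ ε V : ℝ} {b : V3} (hb : ‖b‖ = V) (hκ : 0 ≤ κ) (hε : 0 < ε)
    (hκV : 2 * (V + 1) * κ ≤ 1) {n : ℕ} (x : Fin n → T3) (i j : Fin n) {v v' : V3}
    (h : tubeMark κ (fun q : V3 × V3 × V3 => max 0 (1 - ‖q.2.1 - b‖) * max 0 (1 - ‖q.2.2 + b‖))
      (ε⁻¹ • Torus.reprSym (x i - x j)) v v' ≠ 0) :
    |‖x i‖ - ‖x j‖| ≤ 2 * ε ∧ ‖v‖ < V + 1 ∧ ‖v'‖ < V + 1 := by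
  have hΞ : max 0 (1 - ‖v - b‖) * max 0 (1 - ‖v' + b‖) ≠ 0 := by
    intro h0
    apply h
    unfold tubeMark
    split_ifs
    · exact h0
    · rfl
  obtain ⟨hv, hv', hvv, -⟩ := tml_mark_support_norms hb hΞ
  obtain ⟨-, hsh⟩ := mem_shell_of_tubeMark_ne_zero h
  refine ⟨?_, hv, hv'⟩
  have hq : ‖Torus.reprSym (x i - x j)‖ ≤ 2 * ε := by
    rw [norm_smul, norm_inv, Real.norm_of_nonneg hε.le] at hsh
    have h1 : κ * ‖v - v'‖ ≤ κ * (2 * (V + 1)) := mul_le_mul_of_nonneg_left hvv.le hκ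
    have h2 : ε⁻¹ * ‖Torus.reprSym (x i - x j)‖ ≤ 2 := by nlinarith
    rwa [inv_mul_le_iff₀ hε, mul_comm] at h2
  calc |‖x i‖ - ‖x j‖| ≤ ‖x i - x j‖ := abs_norm_sub_norm_le _ _
    _ ≤ Torus.euclidDist (x i) (x j) := Torus.norm_sub_le_euclidDist_holds (x i) (x j)
    _ = ‖Torus.reprSym (x i - x j)‖ := Torus.euclidDist_eq _ _
    _ ≤ 2 * ε := hq

/-- The comparison integrand `g_{θhot xᵢ}(v) g_{θhot xᵢ}(v') · ½ tubeMark κ Ξ_b (ε⁻¹ reprSym (xᵢ − xⱼ)) v v'` is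
jointly measurable and lies in `[0, 1/2]`. -/
theorem tml_hInt_facts (ε κ : ℝ) (b : V3) {n : ℕ} (i j : Fin n) :
    Measurable (Function.uncurry fun (x : Fin n → T3) (p : V3 × V3) =>
      localMaxwellian 1 (2 - ‖x i‖) (0 : V3) p.1 * localMaxwellian 1 (2 - ‖x i‖) (0 : V3) p.2 *
        (1 / 2 * tubeMark κ (fun q : V3 × V3 × V3 => max 0 (1 - ‖q.2.1 - b‖) * max 0 (1 - ‖q.2.2 + b‖))
          (ε⁻¹ • Torus.reprSym (x i - x j)) p.1 p.2)) ∧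
    ∀ (x : Fin n → T3) (p : V3 × V3),
      localMaxwellian 1 (2 - ‖x i‖) (0 : V3) p.1 * localMaxwellian 1 (2 - ‖x i‖) (0 : V3) p.2 *
        (1 / 2 * tubeMark κ (fun q : V3 × V3 × V3 => max 0 (1 - ‖q.2.1 - b‖) * max 0 (1 - ‖q.2.2 + b‖))
          (ε⁻¹ • Torus.reprSym (x i - x j)) p.1 p.2) ∈ Set.Icc (0 : ℝ) (1 / 2) := by
  set Ξ : V3 × V3 × V3 → ℝ := fun q => max 0 (1 - ‖q.2.1 - b‖) * max 0 (1 - ‖q.2.2 + b‖) with hΞ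
  constructor
  · have h3 : Measurable fun z : (Fin n → T3) × (V3 × V3) =>
        (ε⁻¹ • Torus.reprSym (z.1 i - z.1 j), z.2.1, z.2.2) :=
      ((measurable_sep ε i j).comp measurable_fst).prodMk (measurable_snd.fst.prodMk measurable_snd.snd)
    have ht := (measurable_tubeMark κ (tml_mark_facts b).1).comp h3
    have hg : Measurable fun z : (Fin n → T3) × (V3 × V3) =>
        localMaxwellian 1 (2 - ‖z.1 i‖) (0 : V3) z.2.1 * localMaxwellian 1 (2 - ‖z.1 i‖) (0 : V3) z.2.2 := by
      unfold localMaxwellian; fun_prop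
    exact hg.mul (measurable_const.mul ht)
  · intro x p
    have h1 := (tml_gauss_hot p.1 p.2).2 (x i)
    have h2 := tml_tubeMark_mem κ b (ε⁻¹ • Torus.reprSym (x i - x j)) p.1 p.2
    refine ⟨mul_nonneg h1.1 (mul_nonneg (by norm_num) h2.1), ?_⟩
    calc localMaxwellian 1 (2 - ‖x i‖) (0 : V3) p.1 * localMaxwellian 1 (2 - ‖x i‖) (0 : V3) p.2 *
          (1 / 2 * tubeMark κ Ξ (ε⁻¹ • Torus.reprSym (x i - x j)) p.1 p.2)
        ≤ 1 * (1 / 2 * 1) := by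
          gcongr
          · exact mul_nonneg (by norm_num) h2.1
          · exact h1.2
          · exact h2.2
      _ = 1 / 2 := by norm_num

end Summit.AtomisticToContinuum.HydrodynamicLimit.Theorems.EnergyCurrentTailsRungHalf

end
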